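import Summits.ResolutionOfSingularities.ResolutionOfSingularities.Theorems.FrobeniusClosingPatchingRelPerfectDepthRetractionSNCLift
import Literature.AlgebraicGeometry.Resolution.AlterationsSectionDivisor
import Literature.AlgebraicGeometry.Resolution.BlowupChartMembership
import Literature.AlgebraicGeometry.Resolution.StalkIdealLemmas
import HarnessLib

/-!
# Chain W5.2 — F5 X-side (c), scheme level: at a point of the section `k(E)`, regular parameters of `E` pulled back
# along the retraction `r` together with the equation of `k(E)` form a regular system of parameters of `W`

[OURS · L1 W5.2 · F5 T5-H, E′-locus half] Replaces the role of NO printed item; fact-free. Setting: `k : E ⟶ W` a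
closed immersion with `ker k` an effective Cartier divisor, `r : W ⟶ E` with `k ≫ r = 𝟙 E` (the graded format's
retraction data), the local rings of `E` at `y` and of `W` at `k y` regular. Results (stalks at `x = k y`):

* `liftHom` / `stalkMap_comp_liftHom` — the ring section `φ = r^# ∘ (cast y ⇝ r (k y)) : 𝒪_{E,y} → 𝒪_{W,k y}` and `k^# ∘ φ = id`;
* `exists_ker_stalkMap_eq_span` — `ker k^# = (ker k)_x = (t)` with `t` a non-zero-divisor; `stalkIdeal_comap_retraction` —
  cylinder stalks `(r^*B)_x = φ(B_y)·𝒪_{W,x}`;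
* **`exists_rsop_lift`** — for a regular system of parameters `ū : Fin d → 𝒪_{E,y}` there is a regular system of
  parameters `v : Fin (d+1) → 𝒪_{W,x}` (`emb dim 𝒪_{W,x} = d + 1`) with `v (last) ` generating `(ker k)_x` and, for every
  ideal sheaf `B` on `E` with `B_y = (ū_i : i ∈ S)`, `(r^*B)_x = (v_{castSucc i} : i ∈ S)` — so every member of an snc
  family on `E` through `y` lifts, as the CYLINDER `r^*B`, to a member of an snc family on `W` through `x`, jointly with
  `k(E) = V(t)`, and an snc centre `C_y = (ū_S)` lifts to `(r^*C ⊔ ker k)_x = (v_{castSucc S}, v_last)`.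
  (Ring-level core: `DepthRetract.rsop_lift`, p509647.)

## References
* H. Matsumura, *Commutative Ring Theory* (1986), Thm. 14.2. [Matsumura1987]
* E. Bierstone, D. Grigoriev, P. Milman, J. Włodarczyk, arXiv:1206.3090, Def. 3.1.1, Def. 3.1.3 (2). [BierstoneGrigorievMilmanWlodarczyk2011]
-/

-- `Summit.<Summit>.<Sub>.Theorems` with `Sub = Summit` (single-conjunct summit, D-0017)
set_option linter.dupNamespace false

noncomputable section

open CategoryTheory AlgebraicGeometry TopologicalSpace IsLocalRing
open Literature.AlgebraicGeometry.Resolution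

namespace Summit.ResolutionOfSingularities.ResolutionOfSingularities.Theorems

universe u

namespace DepthRetract

variable {E W : Scheme.{u}} (k : E ⟶ W) [IsClosedImmersion k] (r : W ⟶ E) (hkr : k ≫ r = 𝟙 E)

omit [IsClosedImmersion k] in
include hkr in
/-- `r (k y) = y`. [folklore] -/
theorem retraction_base_apply (y : E) : r.base (k.base y) = y := by
  have h := congrArg (fun f : E ⟶ E => f.base y) hkr
  simpa using h

/-- The cast `𝒪_{E,y} ≅ 𝒪_{E, r (k y)}` along `r (k y) = y`. -/
def castStalk (y : E) : E.presheaf.stalk y ≅ E.presheaf.stalk (r.base (k.base y)) :=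
  E.presheaf.stalkCongr (.of_eq (retraction_base_apply k r hkr y).symm)

/-- The ring section `φ = r^# ∘ cast : 𝒪_{E,y} → 𝒪_{W,k y}`. -/
def liftHom (y : E) : E.presheaf.stalk y →+* W.presheaf.stalk (k.base y) :=
  (r.stalkMap (k.base y)).hom.comp (castStalk k r hkr y).hom.hom

omit [IsClosedImmersion k] in
/-- **The stalk maps of a retraction pair compose to the identity**: `k^# ∘ φ = id` on `𝒪_{E,y}`
(`(k ≫ r)^# = 𝟙` up to the point cast; `Scheme.Hom.stalkMap_comp`, `stalkMap_congr_hom`). [folklore] -/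
theorem stalkMap_comp_liftHom (y : E) :
    (k.stalkMap y).hom.comp (liftHom k r hkr y) = RingHom.id _ := by
  have h1 : (castStalk k r hkr y).hom ≫ r.stalkMap (k.base y) ≫ k.stalkMap y = 𝟙 _ := by
    rw [← Scheme.Hom.stalkMap_comp, Scheme.Hom.stalkMap_congr_hom (k ≫ r) (𝟙 E) hkr y, Scheme.Hom.stalkMap_id]
    erw [Category.comp_id]
    simp [castStalk]
  have h2 := congrArg (fun f => CommRingCat.Hom.hom f) h1
  simpa [liftHom, CommRingCat.hom_comp, RingHom.comp_assoc] using h2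

/-- `ker k^# = (ker k)_{k y}`, generated by a non-zero-divisor `t` when `ker k` is effective Cartier. [folklore] -/
theorem exists_ker_stalkMap_eq_span (hker : IsEffectiveCartier k.ker) (y : E) :
    ∃ t ∈ nonZeroDivisors (W.presheaf.stalk (k.base y)),
      RingHom.ker (k.stalkMap y).hom = Ideal.span {t} ∧ stalkIdeal k.ker (k.base y) = Ideal.span {t} := by
  obtain ⟨t, ht, hst⟩ := hker.exists_stalkIdeal_eq_span (k.base y)
  exact ⟨t, ht, by rw [← stalkIdeal_ker_eq_ker_stalkMap k y, hst], hst⟩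

omit [IsClosedImmersion k] in
/-- Cylinder stalks: `(r^*B)_{k y} = φ(B_y) · 𝒪_{W, k y}`. [folklore] -/
theorem stalkIdeal_comap_retraction (y : E) (B : E.IdealSheafData) :
    stalkIdeal (B.comap r) (k.base y) = (stalkIdeal B y).map (liftHom k r hkr y) := by
  rw [stalkIdeal_comap_eq_map_stalkMap, liftHom, ← Ideal.map_map]
  congr 1
  -- `B_{r (k y)} = cast (B_y)`: transport along `r (k y) = y`
  have key : ∀ {y' : E} (h : y' = r.base (k.base y)),
      stalkIdeal B (r.base (k.base y)) =
        (stalkIdeal B y').map (E.presheaf.stalkCongr (.of_eq h)).hom.hom := by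
    intro y' h
    subst h
    have hid : (E.presheaf.stalkCongr (.of_eq (rfl : r.base (k.base y) = r.base (k.base y)))).hom = 𝟙 _ := by
      rw [TopCat.Presheaf.stalkCongr_hom, TopCat.Presheaf.stalkSpecializes_refl]
    rw [hid]
    simp [Ideal.map_id]
  exact key (retraction_base_apply k r hkr y).symm

include hkr in
/-- [OURS · L1 W5.2] **Regular parameters lift along the retraction, carrying cylinders and the section.** For `y ∈ E`
with `𝒪_{E,y}`, `𝒪_{W,k y}` regular, `ker k` effective Cartier, and a regular system of parameters `ū : Fin d → 𝒪_{E,y}`: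
there is `v : Fin (d+1) → 𝒪_{W, k y}` with `emb dim = d + 1`, `(v) = 𝔪`, `(ker k)_{k y} = (v last)`, and for every ideal
sheaf `B` on `E` and `S ⊆ Fin d` with `B_y = (ū_i : i ∈ S)`: `(r^*B)_{k y} = (v (castSucc i) : i ∈ S)`.
[cite: Matsumura1987, Thm. 14.2] [cite: BierstoneGrigorievMilmanWlodarczyk2011, Def. 3.1.1, Def. 3.1.3 (2)] -/
theorem exists_rsop_lift (y : E) [IsRegularLocalRing (E.presheaf.stalk y)] [IsRegularLocalRing (W.presheaf.stalk (k.base y))]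
    (hker : IsEffectiveCartier k.ker) {d : ℕ} (hd : (maximalIdeal (E.presheaf.stalk y)).spanFinrank = d)
    (u : Fin d → E.presheaf.stalk y) (hu : Ideal.span (Set.range u) = maximalIdeal _) :
    ∃ v : Fin (d + 1) → W.presheaf.stalk (k.base y),
      (maximalIdeal (W.presheaf.stalk (k.base y))).spanFinrank = d + 1 ∧
      Ideal.span (Set.range v) = maximalIdeal _ ∧
      stalkIdeal k.ker (k.base y) = Ideal.span {v (Fin.last d)} ∧
      ∀ (B : E.IdealSheafData) (S : Set (Fin d)), stalkIdeal B y = Ideal.span (u '' S) →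
        stalkIdeal (B.comap r) (k.base y) = Ideal.span (v '' (Fin.castSucc '' S)) := by
  obtain ⟨t, ht, hkerψ, hkt⟩ := exists_ker_stalkMap_eq_span k hker y
  have ht0 : t ≠ 0 := nonZeroDivisors.ne_zero ht
  set φ := liftHom k r hkr y with hφ
  obtain ⟨hrank, hspan⟩ := rsop_lift φ (k.stalkMap y).hom (stalkMap_comp_liftHom k r hkr y)
    (k.stalkMap_surjective y) hkerψ ht0 hd u hu
  refine ⟨Fin.snoc (φ ∘ u) t, hrank, hspan, by simp [hkt], fun B S hB => ?_⟩
  rw [stalkIdeal_comap_retraction k r hkr y B, hB, Ideal.map_span, ← Set.image_comp, ← Set.image_comp]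
  congr 1
  ext b
  simp only [Set.mem_image, Function.comp_apply, Fin.snoc_castSucc]
  rfl

end DepthRetract

end Summit.ResolutionOfSingularities.ResolutionOfSingularities.Theorems

end
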